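import Literature.NumberTheory.GaloisRepresentations.AdditiveVanishing
import Literature.NumberTheory.GaloisRepresentations.FiniteCoefficients
import Mathlib.FieldTheory.Finite.Basic
import HarnessLib

/-!
# Artin–Schreier: `H²(Gal(K̄/F), ℤ/p) = 0` in characteristic `p` (Serre II §2.2 Prop. 3)

For a field `k` of characteristic `p`, the Artin–Schreier sequence
`0 → ℤ/p → K̄ →(℘) K̄ → 0`, `℘(x) = x^p - x`, is an exact sequence of discrete `Γ_k`-modules
(`isSES_artinSchreier`: `℘` is onto since `K̄` is algebraically closed, and its kernel is the
prime field `𝔽_p ⊆ K̄`, the `p` roots of `X^p - X`, a `Γ_k`-submodule with trivial action,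
`primeRep`, of order `p`, `natCard_primeSub`).  With `H¹(H, K̄) = H²(H, K̄) = 0` for open
`H ≤ Γ_k` (`AdditiveVanishing.lean`) the long exact sequence gives

* `subsingleton_two_primeRep_of_charP` — `H²(H, 𝔽_p) = 0` for the trivial module `𝔽_p ≅ ℤ/p`
  and every open subgroup `H` of `Γ_k` (Serre II §2.2 Prop. 3: `cd_p(G_k) ≤ 1` when
  `p = char k`, the case of the module `ℤ/p`).

## References

* J.-P. Serre, *Cohomologie galoisienne* (1997), II §2.2 Prop. 3. [SerreGaloisCohomology1997]
-/

noncomputable section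

open CategoryTheory Topology Field Polynomial

universe u

namespace Literature.NumberTheory.GaloisRepresentations

open _root_.TopRep _root_.ContRepresentation _root_.ContinuousCohomology LocalWeilDatum

attribute [local instance] compactSpace_of_isClosed_subgroup

variable (k : Type u) [Field k] (p : ℕ) [hp : Fact p.Prime] [CharP k p]

/-! ### The prime field inside `K̄` -/

/-- In characteristic `p`, an element `x` of `K̄` with `x ^ p = x` lies in the prime field: the `p`
elements of `ℤ/p` are roots of `X^p - X`, which has at most `p` roots. [folklore] -/
theorem exists_cast_eq_of_pow_eq (x : AlgebraicClosure k) (hx : x ^ p = x) :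
    ∃ n : ZMod p, (ZMod.castHom (dvd_refl p) (AlgebraicClosure k)) n = x := by
  classical
  have hp1 : 1 < p := hp.out.one_lt
  set f : (AlgebraicClosure k)[X] := X ^ p - X with hf
  have hf0 : f ≠ 0 := FiniteField.X_pow_card_sub_X_ne_zero (AlgebraicClosure k) hp1
  have hroot : ∀ y : AlgebraicClosure k, y ∈ f.roots ↔ y ^ p = y := fun y => by
    rw [mem_roots hf0, IsRoot, hf, eval_sub, eval_pow, eval_X, sub_eq_zero]
  -- the image of `ℤ/p` consists of roots
  let S : Finset (AlgebraicClosure k) :=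
    Finset.univ.image (ZMod.castHom (dvd_refl p) (AlgebraicClosure k))
  have hS : S ⊆ f.roots.toFinset := by
    intro y hy
    obtain ⟨n, -, rfl⟩ := Finset.mem_image.1 hy
    rw [Multiset.mem_toFinset, hroot, ← map_pow, ZMod.pow_card]
  have hcardS : S.card = p := by
    rw [Finset.card_image_of_injective _ (ZMod.castHom_injective (AlgebraicClosure k)),
      Finset.card_univ, ZMod.card]
  have hcard : f.roots.toFinset.card ≤ S.card := by
    rw [hcardS]
    calc f.roots.toFinset.card ≤ Multiset.card f.roots := Multiset.toFinset_card_le _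
      _ ≤ f.natDegree := card_roots' f
      _ = p := FiniteField.X_pow_card_sub_X_natDegree_eq (AlgebraicClosure k) hp1
  have heq : S = f.roots.toFinset := Finset.eq_of_subset_of_card_le hS hcard
  have hxS : x ∈ S := by
    rw [heq, Multiset.mem_toFinset, hroot]
    exact hx
  obtain ⟨n, -, hn⟩ := Finset.mem_image.1 hxS
  exact ⟨n, hn⟩

/-! ### The Artin–Schreier sequence -/

/-- The embedding `ℤ/p → K̄` of the prime field, on the carriers. [folklore] -/
def asInclAddHom : ZMod p →+ AddCarrier k :=
  (AddMonoidHom.mk' (fun n => AddCarrier.mk ((ZMod.castHom (dvd_refl p) (AlgebraicClosure k)) n))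
    fun m n => AddCarrier.val_injective (by simp [map_add]))

/-- `val ∘ asIncl = cast`. [folklore] -/
@[simp] theorem val_asInclAddHom (n : ZMod p) :
    (asInclAddHom k p n).val = (ZMod.castHom (dvd_refl p) (AlgebraicClosure k)) n := rfl

/-- The Galois action fixes the prime field. [folklore] -/
theorem smul_castHom (σ : absoluteGaloisGroup k) (n : ZMod p) :
    σ • (ZMod.castHom (dvd_refl p) (AlgebraicClosure k)) n =
      (ZMod.castHom (dvd_refl p) (AlgebraicClosure k)) n := by
  rw [ZMod.castHom_apply, ZMod.cast_eq_val, absoluteGaloisGroup.smul_def, map_natCast]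

/-- **The prime field `𝔽_p ⊆ K̄`** as a `ℤ`-submodule of the additive carrier (the image of
`ℤ/p`). [folklore] -/
def primeSub : Submodule ℤ (AddCarrier k) := LinearMap.range (asInclAddHom k p).toIntLinearMap

/-- Membership in `primeSub`. [folklore] -/
theorem mem_primeSub_iff (x : AddCarrier k) :
    x ∈ primeSub k p ↔ ∃ n : ZMod p, asInclAddHom k p n = x :=
  LinearMap.mem_range

/-- `primeSub` is `Γ_k`-stable (indeed fixed pointwise). [folklore] -/
theorem primeSub_le_comap (σ : absoluteGaloisGroup k) :
    primeSub k p ≤ (primeSub k p).comap (addRep k σ) := by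
  intro x hx
  obtain ⟨n, rfl⟩ := (mem_primeSub_iff k p x).1 hx
  rw [Submodule.mem_comap]
  have h : addRep k σ (asInclAddHom k p n) = asInclAddHom k p n :=
    AddCarrier.val_injective (by rw [addRep_apply_val, val_asInclAddHom, smul_castHom])
  rw [h]
  exact hx

/-- **The trivial discrete `Γ_k`-module `𝔽_p ⊆ K̄`** (as a subrepresentation of `K̄`).
[cite: SerreGaloisCohomology1997, II §2.2] -/
abbrev primeRep : ContinuousRep (absoluteGaloisGroup k) ℤ (primeSub k p) :=
  (addRep k).subrepresentation (primeSub k p) (primeSub_le_comap k p)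

/-- `Γ_k` acts trivially on `𝔽_p`. [folklore] -/
@[simp] theorem primeRep_apply (σ : absoluteGaloisGroup k) (w : primeSub k p) :
    primeRep k p σ w = w := by
  apply Subtype.ext
  rw [ContinuousRep.subrepresentation_apply_coe]
  obtain ⟨n, hn⟩ := (mem_primeSub_iff k p _).1 w.2
  rw [← hn]
  exact AddCarrier.val_injective (by rw [addRep_apply_val, val_asInclAddHom, smul_castHom])

/-- `𝔽_p ⊆ K̄` has `p` elements. [folklore] -/
theorem natCard_primeSub : Nat.card (primeSub k p) = p := by
  have h1 : Nat.card (primeSub k p) = Nat.card (Set.range (asInclAddHom k p)) :=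
    Nat.card_congr (Equiv.subtypeEquivRight fun x => by
      rw [Set.mem_range]
      exact mem_primeSub_iff k p x)
  rw [h1, Nat.card_range_of_injective, Nat.card_zmod]
  intro m n h
  exact ZMod.castHom_injective (AlgebraicClosure k) (congrArg AddCarrier.val h)

/-- **The inclusion `𝔽_p → K̄`** as a morphism of discrete `Γ_k`-modules.
[cite: SerreGaloisCohomology1997, II §2.2] -/
abbrev asι : (primeRep k p).toTopRep ⟶ (addRep k).toTopRep :=
  subtypeHom (addRep k) (primeSub k p) (primeSub_le_comap k p)

/-- `asι` on elements. [folklore] -/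
@[simp] theorem asι_hom_apply (w : primeSub k p) : (asι k p).hom w = (w : AddCarrier k) := rfl

/-- The Artin–Schreier map `℘(x) = x^p - x` on the carrier (additive in characteristic `p`).
[folklore] -/
def asMapAddHom : AddCarrier k →+ AddCarrier k :=
  AddMonoidHom.mk' (fun x => AddCarrier.mk (x.val ^ p - x.val)) fun x y =>
    AddCarrier.val_injective (by
      simp only [AddCarrier.val_mk, AddCarrier.val_add]
      rw [add_pow_char]
      ring)

/-- `℘` on elements. [folklore] -/
@[simp] theorem val_asMapAddHom (x : AddCarrier k) :
    (asMapAddHom k p x).val = x.val ^ p - x.val := rfl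

/-- **The Artin–Schreier map `℘ : K̄ → K̄`** as a morphism of discrete `Γ_k`-modules.
[cite: SerreGaloisCohomology1997, II §2.2] -/
def asπ : (addRep k).toTopRep ⟶ (addRep k).toTopRep :=
  TopRep.ofHom ⟨⟨(asMapAddHom k p).toIntLinearMap, continuous_of_discreteTopology⟩, fun σ => by
    ext x
    apply AddCarrier.val_injective
    change (asMapAddHom k p (addRep k σ x)).val = (addRep k σ (asMapAddHom k p x)).val
    rw [val_asMapAddHom, addRep_apply_val, addRep_apply_val, val_asMapAddHom, smul_sub,
      smul_pow']⟩

/-- `asπ` on elements. [folklore] -/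
@[simp] theorem val_asπ (x : AddCarrier k) : ((asπ k p).hom x).val = x.val ^ p - x.val := rfl

/-- **The Artin–Schreier sequence `0 → ℤ/p → K̄ →(℘) K̄ → 0` is short exact** in characteristic
`p`: the kernel of `℘` is the prime field (`exists_cast_eq_of_pow_eq`) and `℘` is onto because
`K̄` is algebraically closed. [cite: SerreGaloisCohomology1997, II §2.2 Prop. 3] -/
theorem isSES_artinSchreier : IsSES (asι k p) (asπ k p) where
  comp_eq_zero := by
    ext w
    apply AddCarrier.val_injective
    change ((asπ k p).hom ((asι k p).hom w)).val = (0 : AddCarrier k).val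
    obtain ⟨n, hn⟩ := (mem_primeSub_iff k p _).1 w.2
    rw [val_asπ, asι_hom_apply, ← hn, val_asInclAddHom, ← map_pow, ZMod.pow_card, sub_self,
      AddCarrier.val_zero]
  injective := Subtype.val_injective
  exact_mid := fun x hx => by
    have hx' : x.val ^ p = x.val := by
      have h' := congrArg AddCarrier.val hx
      rw [val_asπ, AddCarrier.val_zero, sub_eq_zero] at h'
      exact h'
    obtain ⟨n, hn⟩ := exists_cast_eq_of_pow_eq k p x.val hx'
    have hmem : x ∈ primeSub k p := (mem_primeSub_iff k p x).2 ⟨n, AddCarrier.val_injective (by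
      rw [val_asInclAddHom, hn])⟩
    exact ⟨⟨x, hmem⟩, rfl⟩
  surjective := fun a => by
    have hp1 : 1 < p := hp.out.one_lt
    let f : (AlgebraicClosure k)[X] := X ^ p - X - C a.val
    have hdeg : f.degree = p := by
      have h1 : (X + C a.val : (AlgebraicClosure k)[X]).degree <
          (X ^ p : (AlgebraicClosure k)[X]).degree := by
        rw [degree_X_pow, degree_X_add_C]
        exact mod_cast hp1
      change (X ^ p - X - C a.val : (AlgebraicClosure k)[X]).degree = p
      rw [sub_sub, degree_sub_eq_left_of_degree_lt h1, degree_X_pow]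
    have hf : f.degree ≠ 0 := by
      rw [hdeg]
      exact mod_cast hp.out.ne_zero
    obtain ⟨x, hx⟩ := IsAlgClosed.exists_root f hf
    refine ⟨AddCarrier.mk x, AddCarrier.val_injective ?_⟩
    rw [val_asπ, AddCarrier.val_mk]
    have hx' : x ^ p - x - a.val = 0 := by
      have h2 := hx
      simp only [f, IsRoot, eval_sub, eval_pow, eval_X, eval_C] at h2
      exact h2
    exact sub_eq_zero.1 hx'

/-! ### `H²(H, 𝔽_p) = 0` for open `H ≤ Γ_k` -/

variable {k p}

/-- **`H²(Gal(K̄/F), ℤ/p) = 0` in characteristic `p`** for every open subgroup `H = Gal(K̄/F)` of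
`Γ_k` and the trivial module `𝔽_p ≅ ℤ/p` (Serre II §2.2 Prop. 3): the Artin–Schreier sequence
restricted to `H` and `H¹(H, K̄) = H²(H, K̄) = 0` (`subsingleton_one_addRep`,
`subsingleton_two_addRep`) give `H²(H, 𝔽_p) = 0` by the long exact sequence
(`IsSES.subsingleton_X₁`). [cite: SerreGaloisCohomology1997, II §2.2 Prop. 3] -/
theorem subsingleton_two_primeRep_of_charP (H : Subgroup (absoluteGaloisGroup k))
    (hH : IsOpen (H : Set (absoluteGaloisGroup k))) :
    Subsingleton (continuousCohomology 2
      (((primeRep k p).restrict (subgroupIncl H)).toTopRep)) := by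
  haveI := absoluteGaloisGroup_compactSpace k
  haveI : IsClosed (H : Set (absoluteGaloisGroup k)) := Subgroup.isClosed_of_isOpen H hH
  exact ((isSES_artinSchreier k p).res H).subsingleton_X₁ 0 (subsingleton_one_addRep H hH)
    (subsingleton_two_addRep H hH)

end Literature.NumberTheory.GaloisRepresentations

end
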